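import Summits.HodgeConjecture.HodgeConjecture.Theorems.F0P3cStCharTSStJH              -- ★ ST-JH ∕ ST-PIN milieu: `Gqs`, the pin letters' shapes
import Summits.HodgeConjecture.HodgeConjecture.Theorems.F0P3cStCharTSStOneDim          -- ★ `exists_detNormOne`, `det_proj`
import Literature.NumberTheory.Automorphic.IrreducibleClassesTwist                      -- ★ p853028 CLASS-TWIST KIT
import Literature.NumberTheory.Automorphic.SmoothInductionCharacterTwist                -- ★ `areIsomorphicRep_twist_smoothIndRep`
import HarnessLib

/-!
# F0 · P3c · line LH6 «StCharTS» — «ST-TWIST»: `St_G(ψ·μ) = St_G(ψ) ⊗ (μ ∘ det)` (RIDER 2b «EP-PAIRS», census EP-PAIRS v1 §3 (3))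

Cell `pub/hodgecm-mathlib` (D-0151), FLOOR 0, crux item H413 = `stmt-HodgeConjecture-24833` (`--supports` lane, helper; seat F0P3a-p06 (g25)).  THEOREMS ONLY (no `def` ∕
instance ∕ notation ∕ named fact ∕ `sorry`); the ST-PIN letters (`ι`, `detZ`, `stG`, `detG` and their per-`ψ` clauses, ★ `F0P3cStCharTSStPin.exists_stDetFields`) are READ
as binders.  HONEST LABEL: count-neutral (RIDER 2b input: it turns the EP table entries `Tr St_{ψ′}(conj(ψ∘det)·f_EP^G)` into `Tr St_{ψ′ψ⁻¹}(f_EP^G)` via ★ TRACE-TWIST;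
closes no node); HC_CM is proved only modulo the 7 printed citations (hLiu418 = stmt-HodgeConjecture-24832, h413 = stmt-HodgeConjecture-24833) until rung 0 closes.

MATHEMATICS [Rogawski1990 §12.2 (1) p. 173: «`St_G(ψ) = St_G ⊗ ψ∘det`»; Bushnell–Henniart 2006 §9.5 (9.5.1)].  `St_G(ψ)` is PINNED as THE square-integrable constituent of
`i_G(χ_St(ψ∘ι))`, `χ_St(ψ₀) = ((‖·‖^{1/2}‖·‖^{1/2})⁻¹, ψ₀)`.  For a continuous unitary `μ` of `Z(G)`: (§1) on the Borel, `detZ p = ι(det (proj p))` (`det p = det proj p`, ★ `det_proj`),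
so the inducing line of `χ_St(ψ∘ι)` twisted by `μ∘detZ|_B` IS the inducing line of `χ_St((ψμ)∘ι)` — on the nose (`inducingLine_twist_eq`); (§2) hence
`i_G(χ_St(ψ∘ι)) ⊗ μ∘detZ ≅ i_G(χ_St((ψμ)∘ι))` (★ `areIsomorphicRep_twist_smoothIndRep`), so `St_G(ψ) ⊗ μ∘detZ` is a constituent of the latter (★ `IsConstituentOf.twist`,
★ `of_injective`), and it is square-integrable (★ `isSquareIntegrable_twist_iff`, `‖μ‖ = 1`); the pin's list `{St_G(ψμ), (ψμ)∘det}` with `(ψμ)∘det` NOT square-integrable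
leaves **`St_G(ψ) ⊗ μ∘detZ = St_G(ψμ)`** (`stG_twist_eq`).  The `det` twin `(ψ∘det) ⊗ μ∘det = (ψμ)∘det` is `detG_twist_eq`.

* §1 `detZ_eq_iota_det_proj`, `inducingLine_twist_eq` · §2 `areIsomorphicRep_smoothIndRep_congr`, `isConstituentOf_twist_stG`, **`stG_twist_eq`**, `detG_twist_eq`.

## References
* [Rogawski1990] J. D. Rogawski, *Automorphic Representations of Unitary Groups in Three Variables*, Ann. of Math. Stud. 123 (1990), §12.2 (1) pp. 172–173, §12.1 p. 171, §4.9 p. 54.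
* [BushnellHenniart2006] C. Bushnell, G. Henniart, *The local Langlands conjecture for GL(2)*, Grundlehren 335 (2006), §9.5 (9.5.1) p. 65 (twisting), §17.4.
* [BernsteinZelevinsky1977] I. N. Bernstein, A. V. Zelevinsky, *Induced representations of reductive p-adic groups. I*, Ann. Sci. ÉNS 10 (1977), 1.9, §2.3.
-/

set_option autoImplicit false
-- the mandated namespace has the single-problem summit's repeated segment (`HodgeConjecture.HodgeConjecture`)
set_option linter.dupNamespace false

noncomputable section

open NumberField IsDedekindDomain MeasureTheory
open scoped Matrix MatrixGroups NNReal
open Literature.NumberTheory.Automorphic Literature.NumberTheory.Automorphic.UnitaryGroup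
open Literature.NumberTheory.Rogawski1990

namespace Summit.HodgeConjecture.HodgeConjecture.Cruxes.H413.F0P3cStCharTSStTwist

open Summit.HodgeConjecture.HodgeConjecture.Cruxes.H413

variable (L : Type) [Field L] [NumberField L] [IsCMField L] (v : HeightOneSpectrum (𝓞 ↥(maximalRealSubfield L)))

/-! ## §1 On the Borel: `detZ p = ι(det proj p)`; the inducing line of `χ_St(ψ∘ι)` twisted by `μ∘detZ` is that of `χ_St((ψμ)∘ι)` -/

set_option maxHeartbeats 1600000 in
-- instance-path unification between `Gqs L v` and the literal carrier (class of ★ ST-JH)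
/-- **`detZ p = ι(det (proj p))` on `B`** (the pin clauses `detZ g = (det g)·1`, `ι z = z·1`; `det p = det (proj p)` by ★ `det_proj` at ★ `exists_detNormOne`).
[cite: Rogawski1990, §1.10 p. 9; §4.9 p. 54] -/
theorem detZ_eq_iota_det_proj
    (ι : ↥(normOneUnits (conjLocal L (IsCMField.complexConj L) v)) →* ↥(Subgroup.center (Gqs L v)))
    (hι : ∀ z : ↥(normOneUnits (conjLocal L (IsCMField.complexConj L) v)),
      ((ι z).val.val.val : Matrix (Fin 3) (Fin 3) (LocalRing L v)) = (((z : (LocalRing L v)ˣ) : LocalRing L v)) • (1 : Matrix (Fin 3) (Fin 3) (LocalRing L v)))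
    (detZ : Gqs L v →* ↥(Subgroup.center (Gqs L v)))
    (hdetZ : ∀ g : Gqs L v, ((detZ g).val.val.val : Matrix (Fin 3) (Fin 3) (LocalRing L v)) =
        (g.val.val : Matrix (Fin 3) (Fin 3) (LocalRing L v)).det • (1 : Matrix (Fin 3) (Fin 3) (LocalRing L v)))
    (p : ↥(cmBorelTriple L 3 v).P) :
    detZ (p : ↥(unitaryGroupOfForm (conjLocal L (IsCMField.complexConj L) v) (cmLocalForm L 3 v))) =
      ι (torusDetNormOne (conjLocal L (IsCMField.complexConj L) v) (cmLocalForm L 3 v) (cmLocalForm_eq_over L 3 v) ((cmBorelTriple L 3 v).proj p)) := by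
  obtain ⟨d, hd, -⟩ := F0P3cStCharTSStOneDim.exists_detNormOne L v
  have hdp := F0P3cStCharTSStOneDim.det_proj L v d hd p
  -- `det p = det (proj p)` in `L⁺_v ⊗ L`
  have hdet : (((p : ↥(unitaryGroupOfForm (conjLocal L (IsCMField.complexConj L) v) (cmLocalForm L 3 v))) : GL (Fin 3) (LocalRing L v)) :
        Matrix (Fin 3) (Fin 3) (LocalRing L v)).det =
      (((((cmBorelTriple L 3 v).proj p : ↥(cmBorelTriple L 3 v).M) : ↥(unitaryGroupOfForm (conjLocal L (IsCMField.complexConj L) v) (cmLocalForm L 3 v))) :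
        GL (Fin 3) (LocalRing L v)) : Matrix (Fin 3) (Fin 3) (LocalRing L v)).det := by
    have h := congrArg (fun u : ↥(normOneUnits (conjLocal L (IsCMField.complexConj L) v)) => (((u : (LocalRing L v)ˣ)) : LocalRing L v)) hdp
    dsimp only at h
    rw [hd, hd, Matrix.GeneralLinearGroup.val_det_apply, Matrix.GeneralLinearGroup.val_det_apply] at h
    exact h
  apply Subtype.ext; apply Subtype.ext; apply Units.ext
  rw [hdetZ, hι, coe_torusDetNormOne, coe_torusDet]
  exact congrArg (fun x : LocalRing L v => x • (1 : Matrix (Fin 3) (Fin 3) (LocalRing L v))) hdet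

set_option maxHeartbeats 1600000 in
-- instance-path unification between `Gqs L v` and the literal carrier (the `detZ` rewrite on a Borel element)
/-- **The inducing line of `χ_St(ψ∘ι)`, twisted by `(μ∘detZ)|_B`, IS the inducing line of `χ_St((ψμ)∘ι)`** (equality of representations of `B` on `ℂ`):
`μ(detZ p)·δ^{1/2}(p)·χ₁(α)·ψ(ι det t) = δ^{1/2}(p)·χ₁(α)·(ψμ)(ι det t)` with `t = proj p` (§1 `detZ_eq_iota_det_proj`). [cite: Rogawski1990, §12.2 (1) p. 173; §12.1 p. 171]
[cite: BernsteinZelevinsky1977, 1.9] -/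
theorem inducingLine_twist_eq
    (ι : ↥(normOneUnits (conjLocal L (IsCMField.complexConj L) v)) →* ↥(Subgroup.center (Gqs L v)))
    (hι : ∀ z : ↥(normOneUnits (conjLocal L (IsCMField.complexConj L) v)),
      ((ι z).val.val.val : Matrix (Fin 3) (Fin 3) (LocalRing L v)) = (((z : (LocalRing L v)ˣ) : LocalRing L v)) • (1 : Matrix (Fin 3) (Fin 3) (LocalRing L v)))
    (detZ : Gqs L v →* ↥(Subgroup.center (Gqs L v)))
    (hdetZ : ∀ g : Gqs L v, ((detZ g).val.val.val : Matrix (Fin 3) (Fin 3) (LocalRing L v)) =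
        (g.val.val : Matrix (Fin 3) (Fin 3) (LocalRing L v)).det • (1 : Matrix (Fin 3) (Fin 3) (LocalRing L v)))
    (χ₁ : (LocalRing L v)ˣ →* ℂˣ) (ψ μ : ↥(Subgroup.center (Gqs L v)) →* ℂˣ) :
    haveI := locallyCompactSpace_cmBorelU L 3 v
    (Representation.twist
        (((Representation.trivial ℂ ↥(torusU (conjLocal L (IsCMField.complexConj L) v) (cmLocalForm L 3 v)) ℂ).twist
          (cmTorusCharPair L v χ₁ (ψ.comp ι))).comp (cmBorelTriple L 3 v).proj) (rootDeltaChar (cmBorelTriple L 3 v).P)).twist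
        ((μ.comp detZ).comp (cmBorelTriple L 3 v).P.subtype) =
      Representation.twist
        (((Representation.trivial ℂ ↥(torusU (conjLocal L (IsCMField.complexConj L) v) (cmLocalForm L 3 v)) ℂ).twist
          (cmTorusCharPair L v χ₁ ((ψ * μ).comp ι))).comp (cmBorelTriple L 3 v).proj) (rootDeltaChar (cmBorelTriple L 3 v).P) := by
  haveI := locallyCompactSpace_cmBorelU L 3 v
  ext p
  -- the twisting character on `B`: `μ(detZ p) = μ(ι(det proj p))` (§1), stated on the statement's own term
  have hθp : ((μ.comp detZ).comp (cmBorelTriple L 3 v).P.subtype) p =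
      μ (ι (torusDetNormOne (conjLocal L (IsCMField.complexConj L) v) (cmLocalForm L 3 v) (cmLocalForm_eq_over L 3 v) ((cmBorelTriple L 3 v).proj p))) := by
    exact congrArg μ (detZ_eq_iota_det_proj L v ι hι detZ hdetZ p)
  rw [Representation.twist_apply, hθp]
  simp only [Representation.twist_apply, MonoidHom.comp_apply, Representation.trivial_apply, cmTorusCharPair, torusCharPair_apply,
    MonoidHom.mul_apply, Units.val_mul, smul_eq_mul]
  ring

/-! ## §2 `St_G(ψ) ⊗ μ∘detZ = St_G(ψμ)` -/

/-- Transport of ★ `Liu2021.AreIsomorphicRep ρ (Ind_P σ₁)` along an equality `σ₁ = σ₂` of the inducing representations (the carrier `SmoothInd P σ` depends on `σ`).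
[cite: BernsteinZelevinsky1977, 1.9] -/
theorem areIsomorphicRep_smoothIndRep_congr {G : Type} [Group G] [TopologicalSpace G] [IsTopologicalGroup G] {P : Subgroup G}
    {W V : Type} [AddCommGroup W] [Module ℂ W] [AddCommGroup V] [Module ℂ V] {σ₁ σ₂ : Representation ℂ ↥P W} (h : σ₁ = σ₂)
    {ρ : Representation ℂ G V} (hiso : Liu2021.AreIsomorphicRep ρ (Representation.smoothIndRep P σ₁)) :
    Liu2021.AreIsomorphicRep ρ (Representation.smoothIndRep P σ₂) := by
  subst h
  exact hiso

set_option maxHeartbeats 1600000 in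
set_option synthInstance.maxHeartbeats 400000 in
-- instance-path unification between `Gqs L v` and the literal carrier of ★ `cmPrincipalSeries`
/-- **`St_G(ψ) ⊗ μ∘detZ` is a constituent of `i_G(χ_St((ψμ)∘ι))`**: `St_G(ψ) ∈ JH(i_G(χ_St(ψ∘ι)))` (the pin clause `hJH`), twisting preserves constituents
(★ `IsConstituentOf.twist`), and `i_G(χ_St(ψ∘ι)) ⊗ μ∘detZ ≅ i_G(χ_St((ψμ)∘ι))` (★ `areIsomorphicRep_twist_smoothIndRep` + §1). [cite: Rogawski1990, §12.2 (1) p. 173]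
[cite: BushnellHenniart2006, §9.5 (9.5.1) p. 65] [cite: BernsteinZelevinsky1977, 1.9] -/
theorem isConstituentOf_twist_stG
    (ι : ↥(normOneUnits (conjLocal L (IsCMField.complexConj L) v)) →* ↥(Subgroup.center (Gqs L v)))
    (hι : ∀ z : ↥(normOneUnits (conjLocal L (IsCMField.complexConj L) v)),
      ((ι z).val.val.val : Matrix (Fin 3) (Fin 3) (LocalRing L v)) = (((z : (LocalRing L v)ˣ) : LocalRing L v)) • (1 : Matrix (Fin 3) (Fin 3) (LocalRing L v)))
    (detZ : Gqs L v →* ↥(Subgroup.center (Gqs L v)))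
    (hdetZ : ∀ g : Gqs L v, ((detZ g).val.val.val : Matrix (Fin 3) (Fin 3) (LocalRing L v)) =
        (g.val.val : Matrix (Fin 3) (Fin 3) (LocalRing L v)).det • (1 : Matrix (Fin 3) (Fin 3) (LocalRing L v)))
    (ψ μ : ↥(Subgroup.center (Gqs L v)) →* ℂˣ) (hopenμ : IsOpen (((μ.comp detZ).ker : Subgroup (Gqs L v)) : Set (Gqs L v)))
    {c : IrrClass (Gqs L v)}
    (hc : c.IsConstituentOf (cmPrincipalSeries L 3 v
      (cmTorusCharPair L v (halfModulusChar (LocalRing L v) * halfModulusChar (LocalRing L v))⁻¹ (ψ.comp ι)))) :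
    (c.twist (μ.comp detZ) hopenμ).IsConstituentOf (cmPrincipalSeries L 3 v
      (cmTorusCharPair L v (halfModulusChar (LocalRing L v) * halfModulusChar (LocalRing L v))⁻¹ ((ψ * μ).comp ι))) := by
  haveI := locallyCompactSpace_cmBorelU L 3 v
  -- twist the constituent
  have hct := hc.twist (μ.comp detZ) hopenμ
  -- `i_G(χ) ⊗ θ ≅ Ind_B (line ⊗ θ|_B)` (★), and `line ⊗ θ|_B = line'` on the nose (§1)
  have hiso := areIsomorphicRep_twist_smoothIndRep (cmBorelTriple L 3 v).P
    (Representation.twist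
      (((Representation.trivial ℂ ↥(torusU (conjLocal L (IsCMField.complexConj L) v) (cmLocalForm L 3 v)) ℂ).twist
        (cmTorusCharPair L v (halfModulusChar (LocalRing L v) * halfModulusChar (LocalRing L v))⁻¹ (ψ.comp ι))).comp (cmBorelTriple L 3 v).proj)
      (rootDeltaChar (cmBorelTriple L 3 v).P))
    (μ.comp detZ) hopenμ
  obtain ⟨f, hf⟩ := areIsomorphicRep_smoothIndRep_congr
    (inducingLine_twist_eq L v ι hι detZ hdetZ (halfModulusChar (LocalRing L v) * halfModulusChar (LocalRing L v))⁻¹ ψ μ) hiso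
  -- the intertwining injection `i_G(χ_St(ψ∘ι)) ⊗ μ∘detZ ↪ i_G(χ_St((ψμ)∘ι))`
  refine hct.of_injective ⟨f.toLinearMap, fun g => LinearMap.ext fun w => ?_⟩ (fun a b hab => f.injective (by exact hab))
  exact hf g w

set_option maxHeartbeats 1600000 in
set_option synthInstance.maxHeartbeats 400000 in
-- instance-path unification between `Gqs L v` and the literal carrier of ★ `cmPrincipalSeries`
/-- **«ST-TWIST»: `St_G(ψμ) = St_G(ψ) ⊗ (μ ∘ detZ)`** for continuous `ψ`, `μ` of `Z(G)` with `μ` unitary (READ: the pin clauses `hJH` «`JH(i_G(χ_St(ψ∘ι))) = {St_G(ψ), ψ∘det_G}`»,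
`hStL2` «`St_G` square-integrable», `hDet` «`ψ∘det_G` not square-integrable», at every continuous `ψ`).  `St_G(ψ) ⊗ μ∘detZ` is a constituent of `i_G(χ_St((ψμ)∘ι))`
(`isConstituentOf_twist_stG`) and square-integrable (★ `isSquareIntegrable_twist_iff`), hence it is the square-integrable member `St_G(ψμ)` of the pin's list.
[cite: Rogawski1990, §12.2 (1) p. 173] [cite: BushnellHenniart2006, §9.5 (9.5.1) p. 65, §17.4 p. 117] -/
theorem stG_twist_eq
    [MeasurableSpace (Gqs L v ⧸ Subgroup.center (Gqs L v))] (μZ : Measure (Gqs L v ⧸ Subgroup.center (Gqs L v)))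
    (ι : ↥(normOneUnits (conjLocal L (IsCMField.complexConj L) v)) →* ↥(Subgroup.center (Gqs L v)))
    (hι : ∀ z : ↥(normOneUnits (conjLocal L (IsCMField.complexConj L) v)),
      ((ι z).val.val.val : Matrix (Fin 3) (Fin 3) (LocalRing L v)) = (((z : (LocalRing L v)ˣ) : LocalRing L v)) • (1 : Matrix (Fin 3) (Fin 3) (LocalRing L v)))
    (detZ : Gqs L v →* ↥(Subgroup.center (Gqs L v)))
    (hdetZ : ∀ g : Gqs L v, ((detZ g).val.val.val : Matrix (Fin 3) (Fin 3) (LocalRing L v)) =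
        (g.val.val : Matrix (Fin 3) (Fin 3) (LocalRing L v)).det • (1 : Matrix (Fin 3) (Fin 3) (LocalRing L v)))
    (stG detG : (↥(Subgroup.center (Gqs L v)) →* ℂˣ) → IrrClass (Gqs L v))
    (hJH : ∀ ψ : ↥(Subgroup.center (Gqs L v)) →* ℂˣ, Continuous ψ → ∀ c : IrrClass (Gqs L v),
      c.IsConstituentOf (cmPrincipalSeries L 3 v
        (cmTorusCharPair L v (halfModulusChar (LocalRing L v) * halfModulusChar (LocalRing L v))⁻¹ (ψ.comp ι))) ↔ (c = stG ψ ∨ c = detG ψ))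
    (hStL2 : ∀ ψ : ↥(Subgroup.center (Gqs L v)) →* ℂˣ, Continuous ψ → (stG ψ).IsSquareIntegrable μZ)
    (hDet : ∀ ψ : ↥(Subgroup.center (Gqs L v)) →* ℂˣ, Continuous ψ → ¬ (detG ψ).IsSquareIntegrable μZ)
    (ψ μ : ↥(Subgroup.center (Gqs L v)) →* ℂˣ) (hψ : Continuous ψ) (hμ : Continuous μ) (hμ₁ : ∀ z, ‖((μ z : ℂˣ) : ℂ)‖ = 1)
    (hopenμ : IsOpen (((μ.comp detZ).ker : Subgroup (Gqs L v)) : Set (Gqs L v))) :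
    (stG ψ).twist (μ.comp detZ) hopenμ = stG (ψ * μ) := by
  have hψμ : Continuous ⇑(ψ * μ) := by
    show Continuous fun z => ψ z * μ z
    exact hψ.mul hμ
  -- a constituent of `i_G(χ_St((ψμ)∘ι))` …
  have hcon := isConstituentOf_twist_stG L v ι hι detZ hdetZ ψ μ hopenμ ((hJH ψ hψ (stG ψ)).2 (Or.inl rfl))
  -- … which is square-integrable
  have hL2 : ((stG ψ).twist (μ.comp detZ) hopenμ).IsSquareIntegrable μZ :=
    (IrrClass.isSquareIntegrable_twist_iff μZ hopenμ (fun g => hμ₁ (detZ g)) (stG ψ)).2 (hStL2 ψ hψ)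
  rcases (hJH (ψ * μ) hψμ _).1 hcon with h | h
  · exact h
  · exact absurd (h ▸ hL2) (hDet (ψ * μ) hψμ)

/-- **The `det` twin: `(ψ∘det_G) ⊗ (μ∘detZ) = (ψμ)∘det_G`** (READ: the pin clause `detG ψ = ⟦𝟙 ⊗ ψ∘detZ⟧`; ★ `Representation.twist_twist` on the line).
[cite: Rogawski1990, §12.2 (1) p. 173] [cite: BushnellHenniart2006, §9.5 (9.5.1) p. 65] -/
theorem detG_twist_eq
    (detZ : Gqs L v →* ↥(Subgroup.center (Gqs L v)))
    (detG : (↥(Subgroup.center (Gqs L v)) →* ℂˣ) → IrrClass (Gqs L v))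
    (ψ μ : ↥(Subgroup.center (Gqs L v)) →* ℂˣ)
    (hopenψ : IsOpen ((((ψ.comp detZ).ker : Subgroup (Gqs L v))) : Set (Gqs L v)))
    (hopenμ : IsOpen ((((μ.comp detZ).ker : Subgroup (Gqs L v))) : Set (Gqs L v)))
    (hopenψμ : IsOpen (((((ψ * μ).comp detZ).ker : Subgroup (Gqs L v))) : Set (Gqs L v)))
    (hdetψ : detG ψ = IrrClass.mk (SmoothIrrep.ofChar (ψ.comp detZ) hopenψ))
    (hdetψμ : detG (ψ * μ) = IrrClass.mk (SmoothIrrep.ofChar ((ψ * μ).comp detZ) hopenψμ)) :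
    (detG ψ).twist (μ.comp detZ) hopenμ = detG (ψ * μ) := by
  rw [hdetψ, hdetψμ, IrrClass.twist_mk]
  refine IrrClass.mk_eq_mk_of_equiv (Representation.Equiv.mk (LinearEquiv.refl ℂ _) fun g => ?_)
  change LinearMap.id ∘ₗ (((Representation.trivial ℂ (Gqs L v) ℂ).twist (ψ.comp detZ)).twist (μ.comp detZ)) g =
    ((Representation.trivial ℂ (Gqs L v) ℂ).twist ((ψ * μ).comp detZ)) g ∘ₗ LinearMap.id
  rw [Representation.twist_twist, LinearMap.id_comp, LinearMap.comp_id, MonoidHom.mul_comp]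

end Summit.HodgeConjecture.HodgeConjecture.Cruxes.H413.F0P3cStCharTSStTwist

end
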